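import Mathlib
import HarnessLib

/-!
# `NoHeavyLowerTail` (crux stmt-CriticalPhenomena-4575), antithetic vdBHK programme: exact pieces of the (R)-HEREDITY step — `(R) ⟹ AK`, and the
# SANDWICH LEMMA for the twisted quadruple of a `T²`-up-set

Support file (seat `prim-ineq-gen-7` gen 51; `--supports stmt-CriticalPhenomena-4575`).  No `sorry`, no definitions.  Memo: FINDING-FENCE-g51.md §4d–e.

CONJECTURE H (memo §0, §4): the rearrangement inequality (R) of a polarized involution poset `(X,L)` (hypothesis `hR` of
`AntitheticWedgeTransfer.wedge_transfer`) is inherited by the wedge gluing `(T(X;L), L_T)`; it would make every fence colouring poset antipodal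
Kleitman.  This file records the two exact ingredients of the proof plan of memo §4e.
* `ak_of_R` — (R) already contains AK(X): the constant quadruples `(V,V,V,V)`, `(Y,Y,Y,Y)` are T-pattern and their (R)-instance is `2·AK(V,Y)`.
* `sandwich` — for a `T²`-up-set, written as four T-pattern rows `P = (P₁..P₄)` (outer sheet RB), `U` (RR), `V` (BB), `Q` (BR) of up-sets of `X`
  with the OUTER pattern w.r.t. `L_T = ` sheets `1,2` (`Pⱼ ⊆ Vⱼ`, `Uⱼ ⊆ Qⱼ`, `V₁ ⊆ Q₁`, `V₂ ⊆ Q₂`, `P₃ ⊆ U₃`, `P₄ ⊆ U₄`, and the cross facts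
  `V₁ ⊆ Q₃`, `V₁ ⊆ Q₄`, `V₂ ⊆ Q₄`, `↑(V₂∩L)∖L ⊆ Q₃`), the quadruples `F⁻ = (P₁,P₂,U₃,U₄)` and `F⁺ = (V₁,V₂,Q₃,Q₄)` ARE T-pattern quadruples
  (genuine up-sets of `T(X;L)`), they sandwich the twisted quadruple `F = (V₁,V₂,U₃,U₄)` of the heredity target, and both gaps lie inside the relay
  set `Q ∖ P`: `V₁∖P₁ ⊆ Q₁∖P₁`, `V₂∖P₂ ⊆ Q₂∖P₂`, `Q₃∖U₃ ⊆ Q₃∖P₃`, `Q₄∖U₄ ⊆ Q₄∖P₄` — stated as the twelve elementary consequences.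
-/

namespace Summit.CriticalPhenomena.PercolationContinuityZ3.Theorems

open Finset

namespace AntitheticWedgeSandwich

variable {X : Type*} [PartialOrder X] [DecidableEq X]

/-- **(R) ⟹ AK.**  If (R) holds for `(X,L)` in the quadruple form of `AntitheticWedgeTransfer.wedge_transfer`, then `X` is antipodal Kleitman in
up-set form: apply (R) to the constant quadruples. [this work] -/
theorem ak_of_R (ι : X → X) (L : Finset X)
    (hR : ∀ A₁ A₂ A₃ A₄ B₁ B₂ B₃ B₄ : Finset X,
      (∀ x y, x ≤ y → x ∈ A₁ → y ∈ A₁) → (∀ x y, x ≤ y → x ∈ A₂ → y ∈ A₂) →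
      (∀ x y, x ≤ y → x ∈ A₃ → y ∈ A₃) → (∀ x y, x ≤ y → x ∈ A₄ → y ∈ A₄) →
      (∀ x y, x ≤ y → x ∈ B₁ → y ∈ B₁) → (∀ x y, x ≤ y → x ∈ B₂ → y ∈ B₂) →
      (∀ x y, x ≤ y → x ∈ B₃ → y ∈ B₃) → (∀ x y, x ≤ y → x ∈ B₄ → y ∈ B₄) →
      A₁ ⊆ A₃ → A₂ ⊆ A₄ → (∀ x, x ∈ L → x ∈ A₃ → x ∈ A₄) → (∀ x, x ∉ L → x ∈ A₁ → x ∈ A₂) →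
      (∀ x y, x ≤ y → x ∈ L → y ∉ L → x ∈ A₃ → y ∈ A₄) → (∀ x y, x ≤ y → x ∈ L → y ∉ L → x ∈ A₂ → y ∈ A₃) →
      B₁ ⊆ B₃ → B₂ ⊆ B₄ → (∀ x, x ∈ L → x ∈ B₃ → x ∈ B₄) → (∀ x, x ∉ L → x ∈ B₁ → x ∈ B₂) →
      (∀ x y, x ≤ y → x ∈ L → y ∉ L → x ∈ B₃ → y ∈ B₄) → (∀ x y, x ≤ y → x ∈ L → y ∉ L → x ∈ B₂ → y ∈ B₃) →
      (A₂ ∩ B₃.image ι).card + (A₃ ∩ B₂.image ι).card ≤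
        (A₂ ∩ B₂).card + (A₃ ∩ B₃).card + ((A₄ \ A₁) ∩ (B₄ \ B₁)).card)
    (V Y : Finset X) (hV : ∀ x y, x ≤ y → x ∈ V → y ∈ V) (hY : ∀ x y, x ≤ y → x ∈ Y → y ∈ Y) :
    (V ∩ Y.image ι).card ≤ (V ∩ Y).card := by
  have h := hR V V V V Y Y Y Y hV hV hV hV hY hY hY hY (fun _ h => h) (fun _ h => h) (fun _ _ h => h) (fun _ _ h => h)
    (fun x y hxy _ _ hx => hV x y hxy hx) (fun x y hxy _ _ hx => hV x y hxy hx)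
    (fun _ h => h) (fun _ h => h) (fun _ _ h => h) (fun _ _ h => h)
    (fun x y hxy _ _ hx => hY x y hxy hx) (fun x y hxy _ _ hx => hY x y hxy hx)
  have e : ((V \ V) ∩ (Y \ Y)).card = 0 := by simp
  omega

/-- **SANDWICH LEMMA.**  Rows `P, U, V, Q` (outer sheets RB, RR, BB, BR of a `T²`-up-set) are T-pattern quadruples over `(X,L)` satisfying the
outer pattern w.r.t. `L_T`; then `F⁻ = (P₁,P₂,U₃,U₄)` and `F⁺ = (V₁,V₂,Q₃,Q₄)` are T-pattern quadruples with `F⁻ ⊆ F ⊆ F⁺` sheetwise for the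
twisted quadruple `F = (V₁,V₂,U₃,U₄)`, and the gaps lie in the relay set `Q ∖ P`. (Only the hypotheses actually used are listed.) [this work] -/
theorem sandwich (L : Finset X)
    (P₁ P₂ P₃ P₄ U₃ U₄ V₁ V₂ Q₁ Q₂ Q₃ Q₄ : Finset X)
    -- row P is a T-pattern quadruple (the parts used)
    (p13 : P₁ ⊆ P₃) (p24 : P₂ ⊆ P₄) (p12 : ∀ x, x ∉ L → x ∈ P₁ → x ∈ P₂)
    (pC23 : ∀ x y, x ≤ y → x ∈ L → y ∉ L → x ∈ P₂ → y ∈ P₃)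
    -- row U
    (u34 : ∀ x, x ∈ L → x ∈ U₃ → x ∈ U₄) (uC34 : ∀ x y, x ≤ y → x ∈ L → y ∉ L → x ∈ U₃ → y ∈ U₄)
    -- row V
    (v12 : ∀ x, x ∉ L → x ∈ V₁ → x ∈ V₂)
    -- row Q
    (q34 : ∀ x, x ∈ L → x ∈ Q₃ → x ∈ Q₄) (qC34 : ∀ x y, x ≤ y → x ∈ L → y ∉ L → x ∈ Q₃ → y ∈ Q₄)
    -- outer pattern w.r.t. L_T and its cross facts
    (o13 : P₃ ⊆ U₃) (o14 : P₄ ⊆ U₄) (oP1 : P₁ ⊆ V₁) (oP2 : P₂ ⊆ V₂) (oU3 : U₃ ⊆ Q₃) (oU4 : U₄ ⊆ Q₄)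
    (oV1 : V₁ ⊆ Q₁) (oV2 : V₂ ⊆ Q₂) (c13 : V₁ ⊆ Q₃) (c24 : V₂ ⊆ Q₄)
    (cC23 : ∀ x y, x ≤ y → x ∈ L → y ∉ L → x ∈ V₂ → y ∈ Q₃) :
    -- F⁻ = (P₁,P₂,U₃,U₄) is a T-pattern quadruple
    (P₁ ⊆ U₃ ∧ P₂ ⊆ U₄ ∧ (∀ x, x ∈ L → x ∈ U₃ → x ∈ U₄) ∧ (∀ x, x ∉ L → x ∈ P₁ → x ∈ P₂) ∧
      (∀ x y, x ≤ y → x ∈ L → y ∉ L → x ∈ U₃ → y ∈ U₄) ∧ (∀ x y, x ≤ y → x ∈ L → y ∉ L → x ∈ P₂ → y ∈ U₃)) ∧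
    -- F⁺ = (V₁,V₂,Q₃,Q₄) is a T-pattern quadruple
    (V₁ ⊆ Q₃ ∧ V₂ ⊆ Q₄ ∧ (∀ x, x ∈ L → x ∈ Q₃ → x ∈ Q₄) ∧ (∀ x, x ∉ L → x ∈ V₁ → x ∈ V₂) ∧
      (∀ x y, x ≤ y → x ∈ L → y ∉ L → x ∈ Q₃ → y ∈ Q₄) ∧ (∀ x y, x ≤ y → x ∈ L → y ∉ L → x ∈ V₂ → y ∈ Q₃)) ∧
    -- sandwich F⁻ ⊆ F ⊆ F⁺ and the gaps inside the relay set Q ∖ P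
    (P₁ ⊆ V₁ ∧ P₂ ⊆ V₂ ∧ U₃ ⊆ Q₃ ∧ U₄ ⊆ Q₄ ∧
      V₁ \ P₁ ⊆ Q₁ \ P₁ ∧ V₂ \ P₂ ⊆ Q₂ \ P₂ ∧ Q₃ \ U₃ ⊆ Q₃ \ P₃ ∧ Q₄ \ U₄ ⊆ Q₄ \ P₄) := by
  refine ⟨⟨?_, ?_, u34, p12, uC34, ?_⟩, ⟨c13, c24, q34, v12, qC34, cC23⟩, ⟨oP1, oP2, oU3, oU4, ?_, ?_, ?_, ?_⟩⟩
  · exact fun x hx => o13 (p13 hx)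
  · exact fun x hx => o14 (p24 hx)
  · exact fun x y hxy hxL hyL hx => o13 (pC23 x y hxy hxL hyL hx)
  · intro x hx
    rw [Finset.mem_sdiff] at hx ⊢
    exact ⟨oV1 hx.1, hx.2⟩
  · intro x hx
    rw [Finset.mem_sdiff] at hx ⊢
    exact ⟨oV2 hx.1, hx.2⟩
  · intro x hx
    rw [Finset.mem_sdiff] at hx ⊢
    exact ⟨hx.1, fun h => hx.2 (o13 h)⟩
  · intro x hx
    rw [Finset.mem_sdiff] at hx ⊢
    exact ⟨hx.1, fun h => hx.2 (o14 h)⟩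

end AntitheticWedgeSandwich

end Summit.CriticalPhenomena.PercolationContinuityZ3.Theorems
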